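import Literature.NumberTheory.Sieve.BatemanHornParityBoundary
import Literature.NumberTheory.Sieve.BatemanHornProofs
import Mathlib.NumberTheory.AlmostPrime
import HarnessLib

/-!
# The Bateman–Horn conjecture implies the parity-boundary sieve bounds (on-path certificate)

Topic `Literature/NumberTheory/Sieve`. PROVED here (no facts, no defs): the conjunct
`Literature.NumberTheory.Sieve.BatemanHornConjecture` of the summit implies both named facts of
`BatemanHornParityBoundary.lean`, hence the rung `Rung := UpperBound ∧ AlmostPrimes`:

* `upperBound_of_batemanHornConjecture` — `P_f(x) ~ C(f)/∏deg fᵢ · x/log^k x` gives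
  `P_f(x) ≤ (2^k k! + ε) C(f) x/log^k x` eventually («The bound in Theorem 4 exceeds the generally
  conjectured asymptotic value by the factor 2^k k!» — Greaves, *Sieves in Number Theory*, §2.3,
  after Theorem 4);
* `almostPrimes_of_batemanHornConjecture` — prime values are `P_k` values and every member of a
  Bateman–Horn system has degree `≥ 1` (tree `IsBatemanHornSystem.natDegree_pos`), so the asymptotic
  gives `≥ ½ · C(f)/∏dᵢ · x/log^k x` values with `Ω(∏ fᵢ(n)) ≤ k`;
* `rung_of_batemanHornConjecture` — the conjunction.

So the rung is ON-PATH (`S → Rung`) while its two halves are theorems in print and `S` is open: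
«strictly weaker, with separating witness» in the ladder's sense.
[cite: Greaves2001, §2.3 Theorem 4]

## References
* G. Greaves, *Sieves in Number Theory*, Springer (2001), §2.3 Theorem 4 and the remark following
  it. [Greaves2001]
* P. T. Bateman, R. A. Horn, Math. Comp. 16 (1962) 363–367, (1). [BatemanHorn1962]
-/

open Filter Finset Polynomial Asymptotics

namespace Literature.NumberTheory.Sieve

namespace BatemanHornParityBoundary

/-- A product of `#s` primes is an at-most-`#s`-almost prime (Mathlib `Nat.IsAtMostAlmostPrime`).
[folklore] -/
private theorem isAtMostAlmostPrime_prod_primes {ι : Type*} (a : ι → ℕ) (s : Finset ι)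
    (h : ∀ i ∈ s, (a i).Prime) : Nat.IsAtMostAlmostPrime s.card (∏ i ∈ s, a i) := by
  classical
  induction s using Finset.induction_on with
  | empty => exact ⟨by simp, by simp⟩
  | @insert i s hi ih =>
    rw [prod_insert hi, card_insert_of_notMem hi, add_comm]
    have hp : (a i).Prime := h i (mem_insert_self i s)
    have h1 : Nat.IsAtMostAlmostPrime 1 (a i) := hp.isAlmostPrime_one.isAtMost le_rfl
    exact h1.mul (ih fun j hj ↦ h j (mem_insert_of_mem hj))

/-- **`BatemanHornConjecture → UpperBound`.** The conjectured asymptotic `P_f ~ C/∏deg · x/log^k x`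
is below Selberg's bound `(2^k k! + ε) C x/log^k x` («exceeds the generally conjectured asymptotic
value by the factor 2^k k!»). [cite: Greaves2001, §2.3 Theorem 4 (remark)] -/
theorem upperBound_of_batemanHornConjecture (h : BatemanHornConjecture) : UpperBound := by
  intro k f hf ε hε
  obtain ⟨C, hC, hequiv⟩ := h k f hf
  obtain ⟨C₀, hC₀pos, hC₀⟩ := exists_hasBatemanHornConst_holds (ι := Fin k) hf
  have hCC₀ : C = C₀ := tendsto_nhds_unique hC hC₀
  rw [hC.batemanHornConst_eq]
  have hCpos : 0 < C := hCC₀ ▸ hC₀pos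
  simp only [Fintype.card_fin] at hequiv
  set D : ℝ := ∏ i, ((f i).natDegree : ℝ) with hD
  have hD0 : 0 ≤ D := by
    rw [hD]; exact Finset.prod_nonneg fun i _ ↦ Nat.cast_nonneg _
  -- the numerical inequality `(1 + ε) · C/D ≤ (2^k k! + ε) · C`
  have h2k : (1 : ℝ) ≤ 2 ^ k * (k.factorial : ℝ) := by
    have h1 : (1 : ℝ) ≤ 2 ^ k := one_le_pow₀ (by norm_num)
    have h2 : (1 : ℝ) ≤ (k.factorial : ℝ) := by exact_mod_cast k.factorial_pos
    nlinarith
  have hkey : (1 + ε) * (C / D) ≤ (2 ^ k * (k.factorial : ℝ) + ε) * C := by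
    rcases eq_or_ne D 0 with hD0' | hD0'
    · rw [hD0', div_zero, mul_zero]
      positivity
    · have hD1 : 1 ≤ D := by
        have hnat : D = ((∏ i, (f i).natDegree : ℕ) : ℝ) := by
          rw [hD, Nat.cast_prod]
        rw [hnat] at hD0' ⊢
        have : (∏ i, (f i).natDegree : ℕ) ≠ 0 := by exact_mod_cast hD0'
        exact_mod_cast Nat.one_le_iff_ne_zero.mpr this
      have h1 : C / D ≤ C := div_le_self hCpos.le hD1
      calc (1 + ε) * (C / D) ≤ (1 + ε) * C := by gcongr
        _ ≤ (2 ^ k * (k.factorial : ℝ) + ε) * C := by gcongr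
  -- the eventual inequality from `P_f ~ C/D · x/log^k x`
  have hlo := hequiv.isLittleO
  have hev := hlo.def hε
  have hx1 : ∀ᶠ x : ℕ in atTop, (1 : ℝ) < x := by
    filter_upwards [eventually_gt_atTop 1] with x hx
    exact_mod_cast hx
  filter_upwards [hev, hx1] with x hxb hx1
  have hlog : 0 < Real.log x := Real.log_pos hx1
  have hv : 0 ≤ C / D * (x : ℝ) / Real.log x ^ k := by positivity
  simp only [Pi.sub_apply, Real.norm_eq_abs, abs_of_nonneg hv] at hxb
  have hP : (polyPrimeCount f x : ℝ) ≤ (1 + ε) * (C / D * (x : ℝ) / Real.log x ^ k) := by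
    have := (abs_le.mp hxb).2
    linarith
  have hxl : 0 ≤ (x : ℝ) / Real.log x ^ k := by positivity
  calc (polyPrimeCount f x : ℝ) ≤ (1 + ε) * (C / D * (x : ℝ) / Real.log x ^ k) := hP
    _ = (1 + ε) * (C / D) * ((x : ℝ) / Real.log x ^ k) := by ring
    _ ≤ (2 ^ k * (k.factorial : ℝ) + ε) * C * ((x : ℝ) / Real.log x ^ k) := by gcongr
    _ = (2 ^ k * (k.factorial : ℝ) + ε) * C * (x : ℝ) / Real.log x ^ k := by ring

/-- **`BatemanHornConjecture → AlmostPrimes`** with `r = k` and `c = ½/∏ max(dᵢ,1)`: prime values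
are `P_k` values. [cite: Greaves2001, §2.3 Theorem 4 (remark)] [cite: BatemanHorn1962, (1)] -/
theorem almostPrimes_of_batemanHornConjecture (h : BatemanHornConjecture) : AlmostPrimes := by
  classical
  intro k d
  refine ⟨k, (1 / 2) / ∏ i, (max (d i : ℝ) 1), by positivity, fun f hf hd ↦ ?_⟩
  obtain ⟨C, hC, hequiv⟩ := h k f hf
  obtain ⟨C₀, hC₀pos, hC₀⟩ := exists_hasBatemanHornConst_holds (ι := Fin k) hf
  have hCC₀ : C = C₀ := tendsto_nhds_unique hC hC₀
  rw [hC.batemanHornConst_eq]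
  have hCpos : 0 < C := hCC₀ ▸ hC₀pos
  simp only [Fintype.card_fin] at hequiv
  -- degrees: every `d i ≥ 1`, so `∏ max (d i) 1 = ∏ natDegree (f i)`
  have hdpos : ∀ i, 1 ≤ d i := fun i ↦ hd i ▸ hf.natDegree_pos i
  have hD : (∏ i, (max (d i : ℝ) 1)) = ∏ i, ((f i).natDegree : ℝ) := by
    refine prod_congr rfl fun i _ ↦ ?_
    rw [hd i, max_eq_left]
    exact_mod_cast hdpos i
  have hDpos : 0 < ∏ i, ((f i).natDegree : ℝ) :=
    prod_pos fun i _ ↦ by exact_mod_cast (hd i ▸ hdpos i)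
  rw [hD]
  set D : ℝ := ∏ i, ((f i).natDegree : ℝ)
  -- eventual lower bound `P_f(x) ≥ ½ · C/D · x/log^k x`
  have hlo := hequiv.isLittleO
  have hev := hlo.def (by norm_num : (0 : ℝ) < 1 / 2)
  have hx1 : ∀ᶠ x : ℕ in atTop, (1 : ℝ) < x := by
    filter_upwards [eventually_gt_atTop 1] with x hx
    exact_mod_cast hx
  filter_upwards [hev, hx1] with x hxb hx1
  have hlog : 0 < Real.log x := Real.log_pos hx1
  have hv : 0 ≤ C / D * (x : ℝ) / Real.log x ^ k := by positivity
  simp only [Pi.sub_apply, Real.norm_eq_abs, abs_of_nonneg hv] at hxb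
  have hP : (1 / 2) * (C / D * (x : ℝ) / Real.log x ^ k) ≤ (polyPrimeCount f x : ℝ) := by
    have := (abs_le.mp hxb).1
    linarith
  -- prime values are `P_k` values
  have hsub : (range (x + 1)).filter (fun n : ℕ ↦
        ∀ i, 0 < (f i).eval (n : ℤ) ∧ ((f i).eval (n : ℤ)).toNat.Prime) ⊆
      (range (x + 1)).filter (fun n : ℕ ↦ (∏ i, (f i).eval (n : ℤ)) ≠ 0 ∧
        Nat.IsAtMostAlmostPrime k (∏ i, (f i).eval (n : ℤ)).natAbs) := by
    intro n hn
    rw [mem_filter] at hn ⊢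
    refine ⟨hn.1, ?_, ?_⟩
    · exact (prod_pos fun i _ ↦ (hn.2 i).1).ne'
    · have hnat : (∏ i, (f i).eval (n : ℤ)).natAbs = ∏ i, ((f i).eval (n : ℤ)).natAbs :=
        by first | simp | exact map_prod Int.natAbsHom _ _
      rw [hnat]
      have hk : (univ : Finset (Fin k)).card = k := by simp
      have := isAtMostAlmostPrime_prod_primes (fun i ↦ ((f i).eval (n : ℤ)).natAbs) univ
        (fun i _ ↦ by
          have h1 := (hn.2 i).2
          have h2 : ((f i).eval (n : ℤ)).toNat = ((f i).eval (n : ℤ)).natAbs := by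
            have := Int.toNat_of_nonneg (hn.2 i).1.le
            omega
          rwa [h2] at h1)
      rwa [hk] at this
  have hcard : (polyPrimeCount f x : ℝ) ≤ (polyAlmostPrimeCount f k x : ℝ) := by
    unfold polyPrimeCount polyAlmostPrimeCount
    exact_mod_cast card_le_card hsub
  calc 1 / 2 / D * C * (x : ℝ) / Real.log x ^ k
      = (1 / 2) * (C / D * (x : ℝ) / Real.log x ^ k) := by ring
    _ ≤ (polyPrimeCount f x : ℝ) := hP
    _ ≤ (polyAlmostPrimeCount f k x : ℝ) := hcard

/-- **`BatemanHornConjecture → Rung`.** [cite: Greaves2001, §2.3 Theorem 4 (remark)] -/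
theorem rung_of_batemanHornConjecture (h : BatemanHornConjecture) : Rung :=
  ⟨upperBound_of_batemanHornConjecture h, almostPrimes_of_batemanHornConjecture h⟩

end BatemanHornParityBoundary

end Literature.NumberTheory.Sieve
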